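import Literature.Analysis.FluidPDE.DeRosaGluedStressTransport
import Literature.Analysis.FluidPDE.OnsagerBDSVGluedStageAssembly
import HarnessLib

/-!
# De Rosa's gluing stage, §5.2: Prop. 5.5 and the glued triple from the commutator estimate (assembly)

L. De Rosa, *Infinitely many Leray–Hopf solutions for the fractional Navier–Stokes equations*,
Comm. PDE 44 (2019) 335–365 = arXiv:1801.10235, §5.2. Given the mollified triple
`(v_ℓ, p_ℓ, R̊_ℓ)` (a smooth solution of the fractional NSR system with (5.6)–(5.7′)) and the exact
solutions `vᵢ` of the fractional Navier–Stokes equations (5.9) with the stability bounds of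
Prop. 5.3 and the vector-potential bounds of Prop. 5.4, the glued triple `(v̄_q, p̄_q, R̊̄_q)`
solves the fractional NSR system, `supp R̊̄_q ⊂ 𝕋³ × ⋃ᵢ Iᵢ`, and Prop. 5.5 holds:
(5.13) `‖v̄_q - v_ℓ‖_α ≲ δ_{q+1}^{1/2}ℓ^α`, (5.15) `‖v̄_q‖_{1+N} ≲ δ_q^{1/2}λ_qℓ^{-N}`,
(5.16) `‖R̊̄_q‖_{N+α} ≲ δ_{q+1}ℓ^{-N+α}`, (5.17) `‖(∂ₜ + v̄_q·∇)R̊̄_q‖_{N+α} ≲ δ_{q+1}δ_q^{1/2}λ_qℓ^{-N-α}`,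
(5.18) `|∫|v̄_q|² - |v_ℓ|²| ≲ δ_{q+1}ℓ^α` — "the proof can be found in [BDLSV2017]. However we prove
explicitly (5.18) since it involves the structure of the dissipative term" (p. 14).

This file assembles the De Rosa twin of `BDSV.gluedTripleEstimates_of_commutatorCZBound`
(`OnsagerBDSVGluedStageAssembly.lean`):

* `DeRosa.gluedTriple_of_commutatorCZBound` — **from the commutator estimate
  `BDSV.commutatorCZBound` (BDSV App. D, Prop. D.1, the single published input of BDSV §4 not yet
  proved in the tree)**: for `0 < γ < β < 1/3`, `1 < b < (1-β)/(2β)`, a Hölder exponent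
  `θ ∈ (γ, β)`, every `α ∈ (0,1)`, `N̄`, constants `C_in`, `C₃`, `C_H`, there are `C` and `a₀`
  such that for `a ≥ a₀`, `|ν| ≤ 1`, `T > 0`, `q`, every smooth solution `(v_ℓ, p_ℓ, R̊_ℓ)` of the
  fractional NSR system on `[0,T]` with (5.6), (5.7′) and `θ`-Hölder slices (constant `C_H`), and
  every forward-anchored family of exact fractional Navier–Stokes solutions on the BDSV life spans
  with the stability bounds `BDSV.StabilityBounds` and `BDSV.PotentialBounds` (constant `C₃`,
  orders `≤ N̄ + 2`) — the data of `DeRosa.IsGlueFamily` — the glued triple is a smooth solution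
  of the fractional NSR system on `[0,T]` with stress supported on the glue intervals, (5.13)|₀,
  (5.15), (5.16), (5.17), (5.18) with constant `C` for `N ≤ N̄`, and `v̄(·,0) = v_ℓ(·,0)` — i.e.
  exactly the conclusion of the named fact `DeRosa.gluingStage` (`DeRosaThreeStages.lean`), whose
  remaining inputs are thus the local existence theory of the fractional Navier–Stokes equations
  (De Rosa Thm. 3.4, Prop. 3.5, Cor. 5.2), the stability estimates Props. 5.3–5.4 in the currency
  `BDSV.StabilityBounds`/`BDSV.PotentialBounds`, and `BDSV.commutatorCZBound`;
* the parameter inequalities behind (5.18): `DeRosa.mollScale_eq_monomial`,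
  `DeRosa.glueScale_eq_monomial`, `DeRosa.exists_threshold_glueScale_sq` (De Rosa's
  "`ℓ^{-1-γ} ≤ ℓ^{-4/3} ≤ τ_q^{-2}ℓ^α`": `K τ_q² ℓ^{-1-θ} ≤ 1` for `a` large, given `θ < 1/3` and
  `bβ(1+θ) < (1-β)(1-θ)`, implied by `b < (1-β)/(2β)`), `DeRosa.exists_threshold_glueScale_amp`
  ("`‖v_q‖_γ' ≤ 1`" for the exact solutions: `K τ_q δ_{q+1} ℓ^{-1-θ+α} ≤ 1` for `a` large, given
  `θ < β`), both instances of the master lemma `BDSV.exists_freq_triple_le`.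

Thresholds: `α₀ = 1`; `a₀` is the maximum of `2` and the two thresholds; the constant `C` is the
BDSV one plus the dissipative contribution `12 C_γθ (2C_H + 1)|C₃|` to (5.18).

## References

* L. De Rosa, Comm. PDE 44 (2019) = arXiv:1801.10235, §5.2 (Cor. 5.2, Props. 5.3, 5.4, 5.5,
  (5.7), (5.9), (5.13)–(5.18), the glued triple pp. 12–14). [`Derosa2018`]
* T. Buckmaster, C. De Lellis, L. Székelyhidi Jr., V. Vicol, CPAM 72 (2019) = arXiv:1701.08678,
  §4 (Props. 4.1–4.4), App. C Prop. C.1, App. D Prop. D.1, §2.6 (2.25)–(2.26). [`BuckmasterEtAl2018`]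
-/

noncomputable section

open MeasureTheory Set Filter Topology Function
open scoped NNReal ENNReal ContDiff InnerProductSpace

namespace Literature.Analysis.FluidPDE

namespace DeRosa

open FunctionSpaces FunctionSpaces.Torus
open BDSV hiding IsGlueFamily

/-! ## The scales as monomials in `λ_q`, `λ_{q+1}` and the two thresholds of (5.18) -/

section Params

variable {β α a b : ℝ}

/-- `ℓ = λ_{q+1}^{-β} λ_q^{β - 1 - 3α/2}` (`a ≥ 1`; (5.3) with `δ_q^{1/2} = λ_q^{-β}`). [cite: Derosa2018, §5.1 (5.3)] -/
theorem mollScale_eq_monomial (ha : 1 ≤ a) (q : ℕ) :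
    mollScale β α a b q = freq a b (q + 1) ^ (-β) * freq a b q ^ (β - 1 - 3 * α / 2) := by
  have hf := freq_pos (b := b) ha q
  rw [mollScale_eq ha, ← Real.rpow_add hf, div_eq_mul_inv, ← Real.rpow_neg hf.le]
  congr 1
  congr 1
  ring

/-- `ℓ^s = λ_{q+1}^{-βs} λ_q^{(β - 1 - 3α/2)s}` for real `s` (`a ≥ 1`). [folklore] -/
theorem mollScale_rpow_eq_monomial (ha : 1 ≤ a) (q : ℕ) (s : ℝ) :
    mollScale β α a b q ^ s = freq a b (q + 1) ^ (-β * s) * freq a b q ^ ((β - 1 - 3 * α / 2) * s) := by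
  have hf := freq_pos (b := b) ha q
  have hf1 := freq_pos (b := b) ha (q + 1)
  rw [mollScale_eq_monomial ha q, Real.mul_rpow (Real.rpow_nonneg hf1.le _) (Real.rpow_nonneg hf.le _),
    ← Real.rpow_mul hf1.le, ← Real.rpow_mul hf.le]

/-- `τ_q = ℓ^{2α} λ_q^{β - 1}` (`a ≥ 1`; (5.7) with `δ_q^{1/2} = λ_q^{-β}`). [cite: Derosa2018, §5.2 (5.7)] -/
theorem glueScale_eq_monomial (ha : 1 ≤ a) (q : ℕ) :
    glueScale β α a b q = mollScale β α a b q ^ (2 * α) * freq a b q ^ (β - 1) := by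
  have hf := freq_pos (b := b) ha q
  unfold glueScale
  rw [sqrt_amp ha, div_eq_mul_inv]
  congr 1
  rw [show freq a b q ^ (-β) * freq a b q = freq a b q ^ (-β + 1) by rw [Real.rpow_add hf, Real.rpow_one],
    ← Real.rpow_neg hf.le]
  congr 1
  ring

/-- **`τ_q² ℓ^s` as a monomial**: `τ_q² ℓ^s = λ_q^{(β-1-3α/2)(4α+s) + 2β - 2} λ_{q+1}^{-β(4α+s)}`
(`a ≥ 1`). [folklore] -/
theorem glueScale_sq_mul_mollScale_rpow_eq (ha : 1 ≤ a) (q : ℕ) (s : ℝ) :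
    glueScale β α a b q ^ 2 * mollScale β α a b q ^ s =
      freq a b q ^ ((β - 1 - 3 * α / 2) * (4 * α + s) + (2 * β - 2)) * freq a b (q + 1) ^ (-β * (4 * α + s)) := by
  have hf := freq_pos (b := b) ha q
  have hℓ := mollScale_pos (β := β) (α := α) (b := b) ha q
  have e1 : glueScale β α a b q ^ 2 = mollScale β α a b q ^ (4 * α) * freq a b q ^ (2 * β - 2) := by
    rw [glueScale_eq_monomial ha q, mul_pow, ← Real.rpow_natCast (mollScale β α a b q ^ (2 * α)) 2,
      ← Real.rpow_mul hℓ.le, ← Real.rpow_natCast (freq a b q ^ (β - 1)) 2, ← Real.rpow_mul hf.le]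
    congr 1
    · congr 1; push_cast; ring
    · congr 1; push_cast; ring
  rw [e1, mul_right_comm, ← Real.rpow_add hℓ, mollScale_rpow_eq_monomial ha q (4 * α + s),
    Real.rpow_add hf]
  ring

/-- **`τ_q δ_{q+1} ℓ^s` as a monomial**:
`τ_q δ_{q+1} ℓ^s = λ_q^{(β-1-3α/2)(2α+s) + β - 1} λ_{q+1}^{-β(2α+s) - 2β}` (`a ≥ 1`). [folklore] -/
theorem glueScale_mul_amp_mul_mollScale_rpow_eq (ha : 1 ≤ a) (q : ℕ) (s : ℝ) :
    glueScale β α a b q * amp β a b (q + 1) * mollScale β α a b q ^ s =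
      freq a b q ^ ((β - 1 - 3 * α / 2) * (2 * α + s) + (β - 1)) * freq a b (q + 1) ^ (-β * (2 * α + s) + -2 * β) := by
  have hf := freq_pos (b := b) ha q
  have hf1 := freq_pos (b := b) ha (q + 1)
  have hℓ := mollScale_pos (β := β) (α := α) (b := b) ha q
  have e2 : amp β a b (q + 1) = freq a b (q + 1) ^ (-2 * β) := rfl
  rw [glueScale_eq_monomial ha q, e2]
  calc mollScale β α a b q ^ (2 * α) * freq a b q ^ (β - 1) * freq a b (q + 1) ^ (-2 * β) * mollScale β α a b q ^ s
      = (mollScale β α a b q ^ (2 * α) * mollScale β α a b q ^ s) * freq a b q ^ (β - 1) * freq a b (q + 1) ^ (-2 * β) := by ring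
    _ = (freq a b (q + 1) ^ (-β * (2 * α + s)) * freq a b q ^ ((β - 1 - 3 * α / 2) * (2 * α + s))) *
          freq a b q ^ (β - 1) * freq a b (q + 1) ^ (-2 * β) := by
        rw [← Real.rpow_add hℓ, mollScale_rpow_eq_monomial ha q (2 * α + s)]
    _ = (freq a b q ^ ((β - 1 - 3 * α / 2) * (2 * α + s)) * freq a b q ^ (β - 1)) *
          (freq a b (q + 1) ^ (-β * (2 * α + s)) * freq a b (q + 1) ^ (-2 * β)) := by ring
    _ = _ := by rw [← Real.rpow_add hf, ← Real.rpow_add hf1]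

/-- **The threshold of "`ℓ^{-1-γ} ≤ ℓ^{-4/3} ≤ τ_q^{-2}ℓ^α`"** (De Rosa, proof of (5.18), "remember the
restriction `γ < 1/3`"): for `0 < β < 1`, `1 ≤ b`, `0 ≤ θ < 1/3` with `bβ(1+θ) < (1-β)(1-θ)` (implied
by `b < (1-β)/(2β)` and `θ < 1/3`), `0 ≤ α`, and any `K`, there is `a₁ > 1` with
`K τ_q² ℓ^{-1-θ} ≤ 1` for all `a ≥ a₁` and `q` (the `a`-exponent of the monomial is
`-(1-β)(1-θ) + bβ(1+θ) + α(4β - 5/2 + 3θ/2 - 4bβ) - 6α² < 0`). [cite: Derosa2018, §5.2 Prop. 5.5 (proof of (5.18))] -/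
theorem exists_threshold_glueScale_sq (hβ : 0 < β) (hβ1 : β < 1) (hb : 1 ≤ b) {θ : ℝ}
    (hθ : θ < 1 / 3) (hbθ : b * β * (1 + θ) < (1 - β) * (1 - θ)) (hα : 0 ≤ α) (K : ℝ) :
    ∃ a₁ : ℝ, 1 < a₁ ∧ ∀ a : ℝ, a₁ ≤ a → ∀ q : ℕ,
      K * (glueScale β α a b q ^ 2 * mollScale β α a b q ^ (-1 - θ)) ≤ 1 := by
  set x : ℝ := (β - 1 - 3 * α / 2) * (4 * α + (-1 - θ)) + (2 * β - 2) with hx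
  set y : ℝ := -β * (4 * α + (-1 - θ)) with hy
  have hE : x + b * y + b ^ 2 * 0 < 0 := by
    have h1 : -(1 - β) * (1 - θ) + b * β * (1 + θ) < 0 := by nlinarith
    have h2 : 4 * β - 5 / 2 + 3 * θ / 2 - 4 * b * β < 0 := by nlinarith
    have hexp : x + b * y + b ^ 2 * 0 =
        (-(1 - β) * (1 - θ) + b * β * (1 + θ)) + α * (4 * β - 5 / 2 + 3 * θ / 2 - 4 * b * β) - 6 * α ^ 2 := by
      rw [hx, hy]; ring
    rw [hexp]
    nlinarith [mul_nonneg hα (le_of_lt (neg_pos.2 h2)), sq_nonneg α]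
  obtain ⟨a₁, ha₁, hmain⟩ := exists_freq_triple_le hb hE K
  refine ⟨a₁, ha₁, fun a ha q => ?_⟩
  have ha1 : 1 ≤ a := le_trans ha₁.le ha
  have key := hmain a ha q
  rw [Real.rpow_zero, mul_one] at key
  rwa [glueScale_sq_mul_mollScale_rpow_eq ha1 q (-1 - θ)]

/-- **The threshold of "`‖v_q‖_γ' ≤ 1`" for the exact solutions** (the interpolated Hölder constant
of `vᵢ - v_ℓ` is small): for `0 < β < 1`, `1 ≤ b`, `0 ≤ θ` with `θ(1-β) < bβ(1-θ)` (implied by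
`θ < β` and `b > 1`), `0 ≤ α`, and any `K`, there is `a₁ > 1` with `K τ_q δ_{q+1} ℓ^{-1-θ+α} ≤ 1`
for all `a ≥ a₁` and `q` (the `a`-exponent of the monomial is
`θ(1-β) - bβ(1-θ) + α(3β + 3θ/2 - 3/2 - 3bβ) - 9α²/2 < 0`). [cite: Derosa2018, §5.2 Prop. 5.5 (proof of (5.18))] -/
theorem exists_threshold_glueScale_amp (hβ : 0 < β) (hb : 1 ≤ b) {θ : ℝ}
    (hθ1 : θ ≤ 1) (hbθ : θ * (1 - β) < b * β * (1 - θ)) (hα : 0 ≤ α) (K : ℝ) :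
    ∃ a₁ : ℝ, 1 < a₁ ∧ ∀ a : ℝ, a₁ ≤ a → ∀ q : ℕ,
      K * (glueScale β α a b q * amp β a b (q + 1) * mollScale β α a b q ^ (-1 - θ + α)) ≤ 1 := by
  set x : ℝ := (β - 1 - 3 * α / 2) * (2 * α + (-1 - θ + α)) + (β - 1) with hx
  set y : ℝ := -β * (2 * α + (-1 - θ + α)) + -2 * β with hy
  have hE : x + b * y + b ^ 2 * 0 < 0 := by
    have h1 : θ * (1 - β) - b * β * (1 - θ) < 0 := by linarith
    have h2 : 3 * β + 3 * θ / 2 - 3 / 2 - 3 * b * β ≤ 0 := by nlinarith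
    have hexp : x + b * y + b ^ 2 * 0 =
        (θ * (1 - β) - b * β * (1 - θ)) + α * (3 * β + 3 * θ / 2 - 3 / 2 - 3 * b * β) - 9 / 2 * α ^ 2 := by
      rw [hx, hy]; ring
    rw [hexp]
    nlinarith [mul_nonpos_of_nonneg_of_nonpos hα h2, sq_nonneg α]
  obtain ⟨a₁, ha₁, hmain⟩ := exists_freq_triple_le hb hE K
  refine ⟨a₁, ha₁, fun a ha q => ?_⟩
  have ha1 : 1 ≤ a := le_trans ha₁.le ha
  have key := hmain a ha q
  rw [Real.rpow_zero, mul_one] at key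
  rwa [glueScale_mul_amp_mul_mollScale_rpow_eq ha1 q (-1 - θ + α)]

end Params

/-! ## The assembly: De Rosa's glued triple from the commutator estimate -/

section Assembly

set_option maxHeartbeats 800000 in
/-- **De Rosa §5.2 (the glued triple and Prop. 5.5) from BDSV App. D, Prop. D.1**: given the
commutator estimate `BDSV.commutatorCZBound`, for `0 < γ < β < 1/3`, `1 < b < (1-β)/(2β)` and a
Hölder exponent `θ ∈ (γ, β)` there is `α₀ > 0` (`= 1`) such that for `0 < α < α₀`, every `N̄`,
every family of input constants `(C_N)`, every stability constant `C₃` and every Hölder constant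
`C_H` there are `C` and `a₀ > 1` such that for all `a ≥ a₀`, `|ν| ≤ 1`, `T > 0`, `q`: for every
smooth solution `(v_ℓ, p_ℓ, R̊_ℓ)` of the fractional NSR system on `[0,T] × 𝕋³` with (5.6)
`‖v_ℓ‖_{N+1} ≤ C_N δ_q^{1/2}λ_qℓ^{-N}`, (5.7′) `‖R̊_ℓ‖_{N+α} ≤ C_N δ_{q+1}ℓ^{-N+α}` (all `N`) and
`[v_ℓ(t)]_θ ≤ C_H`, and every family `(uⱼ, pⱼ)` such that, for each `j` with `jτ_q ≤ T`, `(uⱼ, pⱼ)` is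
a smooth exact solution of the fractional Navier–Stokes equations (5.9) on
`Sⱼ = [jτ_q - τ_q, jτ_q + τ_q] ∩ [0,T]` with `uⱼ = v_ℓ` at the left endpoint of `Sⱼ` and the bounds of
Cor. 5.2/Prop. 5.3 (`BDSV.StabilityBounds`, constant `C₃`, orders `≤ N̄ + 2`), and, for each `j`
with `(j+1)τ_q ≤ T`, the pair `(uⱼ, uⱼ₊₁)` obeys the bounds of Prop. 5.4 (`BDSV.PotentialBounds`),
the glued triple `(v̄_q, p̄_q, R̊̄_q)` is a smooth solution of the fractional NSR system on
`[0,T] × 𝕋³` with `supp R̊̄_q ⊂ ⋃ Iᵢ × 𝕋³` (`BDSV.SupportedOnGlueIntervals`), (5.13)|₀, (5.15), (5.16),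
(5.17), (5.18) with constant `C` for `N ≤ N̄`, and `v̄_q(·,0) = v_ℓ(·,0)` — the conclusion of
`DeRosa.gluingStage`. Everything else in the printed §5.2 being proved in the tree
(`DeRosaGluedTriple`, `…Velocity`, `…Energy`, `…StressSize`, `…StressTransport`, with
"`ℛ curl` is a zero-order operator" = `BDSV.holderCZBound_holds`).
[cite: Derosa2018, §5.2 (Props. 5.3–5.5 and the glued triple)] [cite: BuckmasterEtAl2018, App. D Prop. D.1] -/
theorem gluedTriple_of_commutatorCZBound (hcomm : commutatorCZBound) :
    ∀ β : ℝ, 0 < β → β < 1 / 3 → ∀ γ : ℝ, 0 < γ → γ < β →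
      ∀ b : ℝ, 1 < b → b < (1 - β) / (2 * β) →
        ∀ θ : ℝ≥0, γ < (θ : ℝ) → (θ : ℝ) < β →
          ∃ α₀ : ℝ, 0 < α₀ ∧ ∀ α : ℝ, 0 < α → α < α₀ →
            ∀ (Nbar : ℕ) (Cin : ℕ → ℝ) (C₃ : ℝ) (CH : ℝ≥0),
              ∃ (C a₀ : ℝ), 1 < a₀ ∧ ∀ a : ℝ, a₀ ≤ a → ∀ ν : ℝ, |ν| ≤ 1 → ∀ T : ℝ, 0 < T →
                ∀ (q : ℕ) (vℓ : ℝ → UnitAddTorus (Fin 3) → EuclideanSpace ℝ (Fin 3))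
                  (pℓ : ℝ → UnitAddTorus (Fin 3) → ℝ) (Rℓ : ℝ → UnitAddTorus (Fin 3) → Fin 3 → EuclideanSpace ℝ (Fin 3)),
                  Torus.IsFracNSReynoldsOn (Icc 0 T) γ ν vℓ pℓ Rℓ →
                  (∀ N : ℕ, HolderSupLE T vℓ (N + 1) 0
                    (Cin N * (Real.sqrt (amp β a b q) * freq a b q * mollScale β α a b q ^ (-(N : ℝ))))) →
                  (∀ N : ℕ, HolderSupLE T Rℓ N (Real.toNNReal α)
                    (Cin N * (amp β a b (q + 1) * mollScale β α a b q ^ (-(N : ℝ) + α)))) →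
                  (∀ t ∈ Icc 0 T, HolderWith CH θ (vℓ t)) →
                  ∀ (v : ℕ → ℝ → UnitAddTorus (Fin 3) → EuclideanSpace ℝ (Fin 3)) (p : ℕ → ℝ → UnitAddTorus (Fin 3) → ℝ),
                    (∀ i : ℕ, (i : ℝ) * glueScale β α a b q ≤ T →
                      Torus.IsFracNSReynoldsOn (glueInterval T (glueScale β α a b q) i) γ ν (v i) (p i) (fun _ _ _ => 0) ∧
                      v i (max ((i : ℝ) * glueScale β α a b q - glueScale β α a b q) 0) =
                        vℓ (max ((i : ℝ) * glueScale β α a b q - glueScale β α a b q) 0) ∧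
                      StabilityBounds β α a b T C₃ q (Nbar + 2) i vℓ pℓ (v i) (p i)) →
                    (∀ i : ℕ, ((i + 1 : ℕ) : ℝ) * glueScale β α a b q ≤ T →
                      PotentialBounds β α a b T C₃ q (Nbar + 2) i vℓ (v i) (v (i + 1))) →
                      ∃ (vbar : ℝ → UnitAddTorus (Fin 3) → EuclideanSpace ℝ (Fin 3)) (pbar : ℝ → UnitAddTorus (Fin 3) → ℝ)
                        (Rbar : ℝ → UnitAddTorus (Fin 3) → Fin 3 → EuclideanSpace ℝ (Fin 3)),
                        Torus.IsFracNSReynoldsOn (Icc 0 T) γ ν vbar pbar Rbar ∧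
                        SupportedOnGlueIntervals T (glueScale β α a b q) Rbar ∧
                        SupLE T (fun t x => vbar t x - vℓ t x)
                          (C * (Real.sqrt (amp β a b (q + 1)) * mollScale β α a b q ^ α)) ∧
                        (∀ N : ℕ, N ≤ Nbar → HolderSupLE T vbar (N + 1) 0
                          (C * (Real.sqrt (amp β a b q) * freq a b q * mollScale β α a b q ^ (-(N : ℝ))))) ∧
                        (∀ N : ℕ, N ≤ Nbar → HolderSupLE T Rbar N (Real.toNNReal α)
                          (C * (amp β a b (q + 1) * mollScale β α a b q ^ (-(N : ℝ) + α)))) ∧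
                        (∀ N : ℕ, N ≤ Nbar → HolderSupLE T (advectiveDeriv T vbar Rbar) N (Real.toNNReal α)
                          (C * (amp β a b (q + 1) * Real.sqrt (amp β a b q) * freq a b q *
                            mollScale β α a b q ^ (-(N : ℝ) - α)))) ∧
                        (∀ t ∈ Icc 0 T, |(∫ x, ‖vbar t x‖ ^ 2) - ∫ x, ‖vℓ t x‖ ^ 2| ≤
                          C * (amp β a b (q + 1) * mollScale β α a b q ^ α)) ∧
                        vbar 0 = vℓ 0 := by
  intro β hβ hβ3 γ hγ hγβ b hb hb' θ hθγ hθβ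
  refine ⟨1, one_pos, fun α hα hα1 Nbar Cin C₃ CH => ?_⟩
  have hα' : 0 < Real.toNNReal α := Real.toNNReal_pos.2 hα
  have hα1' : Real.toNNReal α < 1 := Real.toNNReal_lt_one.2 hα1
  have hb1 : 1 ≤ b := hb.le
  have hβ0 : 0 ≤ β := hβ.le
  have hβ1 : β < 1 := by linarith
  have hθ0 : 0 ≤ (θ : ℝ) := θ.coe_nonneg
  have hθ3 : (θ : ℝ) < 1 / 3 := by linarith
  have hθ1 : (θ : ℝ) ≤ 1 := by linarith
  -- the traceless square as a bilinear map
  obtain ⟨B, hB⟩ := exists_tracelessCLM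
  -- the dissipative constant (Thm. 7.1 at exponent `γ/2`)
  obtain ⟨Cd, hCd0, hCd⟩ := Torus.exists_abs_dissipation_sub_le_of_holder (Fin 3) hγ hθγ hθ1
  -- Calderón–Zygmund constants (App. C, proved) and commutator constants (App. D, Prop. D.1)
  have hczex : ∀ m : ℕ, ∃ C : ℝ≥0∞, C ≠ ⊤ ∧ ∀ z : UnitAddTorus (Fin 3) → EuclideanSpace ℝ (Fin 3), IsSmooth z →
      Torus.eContDiffHolderNorm m (Real.toNNReal α) (fun x => Torus.antidivergence (BDSV.curl z) x) ≤
        C * Torus.eContDiffHolderNorm m (Real.toNNReal α) z :=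
    fun m => holderCZBound_holds.antidivergence_curl_le hα' hα1' m
  choose Ccz hCczT hCcz using hczex
  have hcmex : ∀ m : ℕ, ∃ C : ℝ≥0∞, C ≠ ⊤ ∧ ∀ bb z : UnitAddTorus (Fin 3) → EuclideanSpace ℝ (Fin 3), IsSmooth bb → IsSmooth z →
      Torus.eContDiffHolderNorm m (Real.toNNReal α)
          (fun x => FunctionSpaces.Torus.convect bb (fun y => Torus.antidivergence (BDSV.curl z) y) x -
            Torus.antidivergence (BDSV.curl (FunctionSpaces.Torus.convect bb z)) x) ≤
        C * (Torus.eContDiffHolderNorm 1 (Real.toNNReal α) bb * Torus.eContDiffHolderNorm m (Real.toNNReal α) z +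
          Torus.eContDiffHolderNorm (m + 1) (Real.toNNReal α) bb * Torus.eContDiffHolderNorm 0 (Real.toNNReal α) z) :=
    fun m => hcomm.antidivergence_curl_le hα' hα1' m
  choose Ccm hCcmT hCcm using hcmex
  -- one Calderón–Zygmund constant for all orders `≤ N̄ + 2`
  set Cz : ℝ≥0∞ := ∑ m ∈ Finset.range (Nbar + 3), Ccz m with hCzdef
  have hCzT : Cz ≠ ⊤ := ENNReal.sum_ne_top.2 fun m _ => hCczT m
  have hCz : ∀ m : ℕ, m ≤ Nbar + 2 → ∀ z : UnitAddTorus (Fin 3) → EuclideanSpace ℝ (Fin 3), IsSmooth z →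
      Torus.eContDiffHolderNorm m (Real.toNNReal α) (fun x => Torus.antidivergence (BDSV.curl z) x) ≤
        Cz * Torus.eContDiffHolderNorm m (Real.toNNReal α) z := by
    intro m hm z hz
    refine (hCcz m z hz).trans (mul_le_mul' ?_ le_rfl)
    exact Finset.single_le_sum (f := Ccz) (fun _ _ => bot_le) (Finset.mem_range.2 (by omega))
  -- the constants of (5.16) and (5.17) at each order
  set K20 : ℕ → ℝ≥0∞ := fun N =>
    ENNReal.ofReal (stepProfileBound 1 * |C₃|) * Cz + 3 ^ N * ‖B‖ₑ * ((N + 1 : ℕ) * ENNReal.ofReal (4 * C₃ ^ 2)) with hK20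
  set K21 : ℕ → ℝ≥0∞ := fun N =>
    Cz * ENNReal.ofReal ((stepProfileBound 2 + stepProfileBound 1) * |C₃|) +
      Ccm N * ENNReal.ofReal (stepProfileBound 1 *
        ((((0 : ℕ) : ℝ) + 4) * |Cin 0| + |Cin (0 + 1)| + ((((N : ℕ) : ℝ) + 4) * |Cin N| + |Cin (N + 1)|)) * |C₃|) +
      3 ^ N * ‖B‖ₑ * ((N + 1 : ℕ) * ENNReal.ofReal (8 * (stepProfileBound 1 + 1) * C₃ ^ 2)) +
      3 ^ N * ((N + 1 : ℕ) * ENNReal.ofReal |C₃|) *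
        (ENNReal.ofReal (stepProfileBound 1 * |C₃|) * Cz + 3 ^ (N + 1) * ‖B‖ₑ * ((N + 1 + 1 : ℕ) * ENNReal.ofReal (4 * C₃ ^ 2)))
    with hK21
  have hK20T : ∀ N, K20 N ≠ ⊤ := fun N => stressSizeConst_ne_top B C₃ hCzT N
  have hK21T : ∀ N, K21 N ≠ ⊤ := by
    intro N
    have h3 : ∀ k : ℕ, (3 : ℝ≥0∞) ^ k ≠ ⊤ := fun k => ENNReal.pow_ne_top (by norm_num)
    refine ENNReal.add_ne_top.2 ⟨ENNReal.add_ne_top.2 ⟨ENNReal.add_ne_top.2 ⟨?_, ?_⟩, ?_⟩, ?_⟩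
    · exact ENNReal.mul_ne_top hCzT ENNReal.ofReal_ne_top
    · exact ENNReal.mul_ne_top (hCcmT N) ENNReal.ofReal_ne_top
    · exact ENNReal.mul_ne_top (ENNReal.mul_ne_top (h3 N) enorm_ne_top) (ENNReal.mul_ne_top (ENNReal.natCast_ne_top _) ENNReal.ofReal_ne_top)
    · exact ENNReal.mul_ne_top (ENNReal.mul_ne_top (h3 N) (ENNReal.mul_ne_top (ENNReal.natCast_ne_top _) ENNReal.ofReal_ne_top))
        (stressSizeConst_ne_top B C₃ hCzT (N + 1))
  -- the energy constant (with the dissipative contribution)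
  set E22 : ℝ := 12 * Cin 0 ^ 2 + 4 * C₃ ^ 2 + 12 * Cd * (2 * CH + 1) * |C₃| with hE22
  have hE22_0 : 0 ≤ E22 := by rw [hE22]; positivity
  -- the output constant
  set C : ℝ := |C₃| + (∑ N ∈ Finset.range (Nbar + 1), (|Cin N| + 3 * |C₃|)) +
    (∑ N ∈ Finset.range (Nbar + 1), (K20 N).toReal) + (∑ N ∈ Finset.range (Nbar + 1), (K21 N).toReal) + E22 with hCdef
  have hS19 : 0 ≤ ∑ N ∈ Finset.range (Nbar + 1), (|Cin N| + 3 * |C₃|) := Finset.sum_nonneg fun _ _ => by positivity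
  have hS20 : 0 ≤ ∑ N ∈ Finset.range (Nbar + 1), (K20 N).toReal := Finset.sum_nonneg fun _ _ => ENNReal.toReal_nonneg
  have hS21 : 0 ≤ ∑ N ∈ Finset.range (Nbar + 1), (K21 N).toReal := Finset.sum_nonneg fun _ _ => ENNReal.toReal_nonneg
  have hC18 : |C₃| ≤ C := by rw [hCdef]; nlinarith [abs_nonneg C₃]
  have hC19 : ∀ N : ℕ, N ≤ Nbar → |Cin N| + 3 * |C₃| ≤ C := by
    intro N hN
    have h1 : |Cin N| + 3 * |C₃| ≤ ∑ N ∈ Finset.range (Nbar + 1), (|Cin N| + 3 * |C₃|) :=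
      Finset.single_le_sum (f := fun N => |Cin N| + 3 * |C₃|) (fun _ _ => by positivity) (Finset.mem_range.2 (Nat.lt_succ_of_le hN))
    rw [hCdef]; nlinarith [abs_nonneg C₃]
  have hC20 : ∀ N : ℕ, N ≤ Nbar → (K20 N).toReal ≤ C := by
    intro N hN
    have h1 : (K20 N).toReal ≤ ∑ N ∈ Finset.range (Nbar + 1), (K20 N).toReal :=
      Finset.single_le_sum (f := fun N => (K20 N).toReal) (fun _ _ => ENNReal.toReal_nonneg) (Finset.mem_range.2 (Nat.lt_succ_of_le hN))
    rw [hCdef]; nlinarith [abs_nonneg C₃]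
  have hC21 : ∀ N : ℕ, N ≤ Nbar → (K21 N).toReal ≤ C := by
    intro N hN
    have h1 : (K21 N).toReal ≤ ∑ N ∈ Finset.range (Nbar + 1), (K21 N).toReal :=
      Finset.single_le_sum (f := fun N => (K21 N).toReal) (fun _ _ => ENNReal.toReal_nonneg) (Finset.mem_range.2 (Nat.lt_succ_of_le hN))
    rw [hCdef]; nlinarith [abs_nonneg C₃]
  have hC22 : E22 ≤ C := by rw [hCdef]; nlinarith [abs_nonneg C₃]
  -- the two thresholds of (5.18)
  have hbθ1 : b * β * (1 + (θ : ℝ)) < (1 - β) * (1 - (θ : ℝ)) := by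
    -- `bβ < (1-β)/2` and `(1+θ)/2 < 1 - θ` (`θ < 1/3`)
    have h1 : b * β < (1 - β) / 2 := by
      have h2β : 0 < 2 * β := by linarith
      have := (lt_div_iff₀ h2β).1 hb'
      linarith
    nlinarith
  have hbθ2 : (θ : ℝ) * (1 - β) < b * β * (1 - (θ : ℝ)) := by
    -- `θ(1-β) < β(1-θ) ≤ bβ(1-θ)`
    have h1 : (θ : ℝ) * (1 - β) < β * (1 - (θ : ℝ)) := by nlinarith
    have h2 : β * (1 - (θ : ℝ)) ≤ b * β * (1 - (θ : ℝ)) := by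
      have : 0 ≤ β * (1 - (θ : ℝ)) := by positivity
      nlinarith
    linarith
  obtain ⟨a₁, ha₁, hP1⟩ := exists_threshold_glueScale_sq (b := b) hβ hβ1 hb1 hθ3 hbθ1 hα.le 1
  obtain ⟨a₂, ha₂, hP2⟩ := exists_threshold_glueScale_amp (b := b) hβ hb1 hθ1 hbθ2 hα.le (3 * |C₃|)
  refine ⟨C, max 2 (max a₁ a₂), lt_of_lt_of_le one_lt_two (le_max_left _ _),
    fun a ha ν hν T hT q vℓ pℓ Rℓ hNSR h213 h214 hHol v p hfam hpot => ?_⟩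
  have ha2 : 2 ≤ a := le_trans (le_max_left _ _) ha
  have ha1 : 1 ≤ a := by linarith
  have haa₁ : a₁ ≤ a := le_trans ((le_max_left _ _).trans (le_max_right _ _)) ha
  have haa₂ : a₂ ≤ a := le_trans ((le_max_right _ _).trans (le_max_right _ _)) ha
  -- the anchored family
  set τ := glueScale β α a b q with hτdef
  have hτ : 0 < τ := glueScale_pos ha1 q
  set n : ℕ := ⌊T / τ⌋₊ with hndef
  have hn : (n : ℝ) * τ ≤ T := by
    have := Nat.floor_le (div_nonneg hT.le hτ.le)
    rwa [le_div_iff₀ hτ] at this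
  have hn' : T < ((n : ℝ) + 1) * τ := by
    have := Nat.lt_floor_add_one (T / τ)
    rwa [div_lt_iff₀ hτ] at this
  have hglue : IsGlueFamily γ ν T τ n vℓ pℓ Rℓ v p :=
    { hγ := hγ
      hT := hT
      hτ := hτ
      hn := hn
      hn' := hn'
      nsr := hNSR
      exact := fun i hi => (hfam i hi).1
      anchor := fun i hi => (hfam i hi).2.1 }
  have hS : ∀ i : ℕ, i ≤ n → StabilityBounds β α a b T C₃ q (Nbar + 2) i vℓ pℓ (v i) (p i) :=
    fun i hi => (hfam i (hglue.anchor_le hi)).2.2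
  have hP : ∀ i : ℕ, i < n → PotentialBounds β α a b T C₃ q (Nbar + 2) i vℓ (v i) (v (i + 1)) :=
    fun i hi => hpot i (hglue.anchor_le (Nat.succ_le_of_lt hi))
  -- positivity of the parameter expressions
  have hℓ : 0 < mollScale β α a b q := mollScale_pos ha1 q
  have hδ : 0 < amp β a b (q + 1) := amp_pos ha1 (q + 1)
  have hfreq : 0 < freq a b q := freq_pos ha1 q
  have hamp : 0 < amp β a b q := amp_pos ha1 q
  refine ⟨gluedVel τ n v, gluedPres τ n v p, gluedStress τ n v, hglue.isFracNSReynoldsOn_glued,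
    hglue.supportedOnGlueIntervals_gluedStress, ?_, ?_, ?_, ?_, ?_, hglue.gluedVel_zero⟩
  · -- (5.13)|₀
    refine (hglue.supLE_gluedVel_sub hS ha1 hb1 hβ0 hα.le).mono ?_
    exact mul_le_mul_of_nonneg_right hC18 (by positivity)
  · -- (5.15)
    intro N hN
    refine (hglue.holderSupLE_gluedVel hS ha1 hb1 hβ0 hα.le h213 (show N + 1 ≤ Nbar + 2 by omega)).mono ?_
    exact mul_le_mul_of_nonneg_right (hC19 N hN) (by positivity)
  · -- (5.16)
    intro N hN
    refine (hglue.holderSupLE_gluedStress hB hS hP ha1 hb1 hβ0 hα.le (show N ≤ Nbar + 2 by omega) hCzT (hCz N (by omega))).mono ?_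
    exact mul_le_mul_of_nonneg_right (hC20 N hN) (by positivity)
  · -- (5.17)
    intro N hN t ht
    have hmain := hglue.eContDiffHolderNorm_advectiveDeriv_gluedStress_le hB hS hP ha1 hb1 hβ0 hα hα1 h213
      (show N + 1 ≤ Nbar + 2 by omega) (Ccz := Cz) (Ccm := Ccm N) (fun m hm => hCz m (by omega)) (hCcm N) ht
    refine hmain.trans ?_
    rw [mul_ofReal_eq_ofReal_toReal_mul (hK21T N)]
    exact ENNReal.ofReal_le_ofReal (mul_le_mul_of_nonneg_right (hC21 N hN) (by positivity))
  · -- (5.18), with the dissipative term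
    intro t ht
    set Bst : ℝ := 3 * |C₃| * (τ * amp β a b (q + 1) * mollScale β α a b q ^ (-1 - (θ : ℝ) + α)) with hBst
    have hBst0 : 0 ≤ Bst := by positivity
    have hBst1 : Bst ≤ 1 := by
      have := hP2 a haa₂ q
      rwa [hBst]
    have hBi : ∀ i : ℕ, i ≤ n → ∀ s ∈ glueInterval T τ i, ∀ y z : EuclideanSpace ℝ (Fin 3),
        ‖(v i s (proj y) - vℓ s (proj y)) - (v i s (proj z) - vℓ s (proj z))‖ ≤ Bst * ‖y - z‖ ^ (θ : ℝ) :=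
      fun i hi s hs y z => hglue.holder_lift_velocity_sub hS (by omega) ha1 hθ0 hθ1 hi hs y z
    have hKb : ∀ i : ℕ, i ≤ n → ∀ s ∈ glueInterval T τ i,
        |(∫ x, ⟪Torus.fracLaplacian γ (v i s) x, v i s x⟫_ℝ) - ∫ x, ⟪Torus.fracLaplacian γ (vℓ s) x, vℓ s x⟫_ℝ| ≤
          Cd * (2 * CH + Bst) * Bst :=
      fun i hi s hs => hglue.dissipation_sub_le (θ := θ) (C := Cd) hCd hHol hi hBst0 (hBi i hi) hs
    have hE := hglue.abs_energy_gluedVel_sub_le hS ha1 hb1 hβ0 hα.le h213 h214 hKb ht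
    refine hE.trans ?_
    -- the dissipative contribution: `4|ν| C_d (2C_H + B) B τ ≤ 12 C_d (2C_H + 1)|C₃| δ ℓ^α`
    have hBτ : Bst * τ ≤ 3 * |C₃| * (amp β a b (q + 1) * mollScale β α a b q ^ α) := by
      have hP1' : τ ^ 2 * mollScale β α a b q ^ (-1 - (θ : ℝ)) ≤ 1 := by
        have := hP1 a haa₁ q
        rwa [one_mul] at this
      have e : Bst * τ = 3 * |C₃| * (amp β a b (q + 1) * mollScale β α a b q ^ α) *
          (τ ^ 2 * mollScale β α a b q ^ (-1 - (θ : ℝ))) := by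
        rw [hBst, show (-1 - (θ : ℝ) + α) = α + (-1 - (θ : ℝ)) by ring, Real.rpow_add hℓ]
        ring
      rw [e]
      exact mul_le_of_le_one_right (by positivity) hP1'
    have hdiss : 4 * |ν| * (Cd * (2 * CH + Bst) * Bst) * τ ≤
        12 * Cd * (2 * CH + 1) * |C₃| * (amp β a b (q + 1) * mollScale β α a b q ^ α) := by
      have h1 : 4 * |ν| * (Cd * (2 * CH + Bst) * Bst) * τ ≤ 4 * 1 * (Cd * (2 * CH + 1) * Bst) * τ := by
        have hB2 : Cd * (2 * CH + Bst) * Bst ≤ Cd * (2 * CH + 1) * Bst := by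
          apply mul_le_mul_of_nonneg_right _ hBst0
          exact mul_le_mul_of_nonneg_left (by linarith) hCd0
        have : 0 ≤ Cd * (2 * CH + Bst) * Bst := by positivity
        have hν0 : 0 ≤ |ν| := abs_nonneg ν
        calc 4 * |ν| * (Cd * (2 * CH + Bst) * Bst) * τ ≤ 4 * 1 * (Cd * (2 * CH + Bst) * Bst) * τ := by
              gcongr
          _ ≤ 4 * 1 * (Cd * (2 * CH + 1) * Bst) * τ := by gcongr
      calc 4 * |ν| * (Cd * (2 * CH + Bst) * Bst) * τ ≤ 4 * 1 * (Cd * (2 * CH + 1) * Bst) * τ := h1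
        _ = 4 * Cd * (2 * CH + 1) * (Bst * τ) := by ring
        _ ≤ 4 * Cd * (2 * CH + 1) * (3 * |C₃| * (amp β a b (q + 1) * mollScale β α a b q ^ α)) :=
            mul_le_mul_of_nonneg_left hBτ (by positivity)
        _ = 12 * Cd * (2 * CH + 1) * |C₃| * (amp β a b (q + 1) * mollScale β α a b q ^ α) := by ring
    calc (12 * Cin 0 ^ 2 + 4 * C₃ ^ 2) * (amp β a b (q + 1) * mollScale β α a b q ^ α) +
          4 * |ν| * (Cd * (2 * CH + Bst) * Bst) * τ
        ≤ (12 * Cin 0 ^ 2 + 4 * C₃ ^ 2) * (amp β a b (q + 1) * mollScale β α a b q ^ α) +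
            12 * Cd * (2 * CH + 1) * |C₃| * (amp β a b (q + 1) * mollScale β α a b q ^ α) := by linarith
      _ = E22 * (amp β a b (q + 1) * mollScale β α a b q ^ α) := by rw [hE22]; ring
      _ ≤ C * (amp β a b (q + 1) * mollScale β α a b q ^ α) := mul_le_mul_of_nonneg_right hC22 (by positivity)

end Assembly

end DeRosa

end Literature.Analysis.FluidPDE
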